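import Summits.BirchSwinnertonDyer.BirchSwinnertonDyer.Theorems.SchneiderFreeAdditiveX3BranchSocketConjFrame
import Summits.BirchSwinnertonDyer.BirchSwinnertonDyer.Theorems.SchneiderFreeAdditiveX3BranchFlatRigidity
import Summits.BirchSwinnertonDyer.BirchSwinnertonDyer.Theorems.SchneiderFreeAdditiveX3BranchFrameMatchOfMultiplier
import Summits.BirchSwinnertonDyer.BirchSwinnertonDyer.Theorems.SchneiderFreeAdditiveX3PresentationLZZTwistValue
import Summits.BirchSwinnertonDyer.BirchSwinnertonDyer.Theorems.SchneiderFreeAdditiveX3GordTwoBranchIMCOfKYBranch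
import Summits.BirchSwinnertonDyer.BirchSwinnertonDyer.Theorems.SchneiderFreeAdditiveX3LeafOffSliver
import Literature.NumberTheory.EllipticCurves.CastellaHsieh2018.BranchBDPLFunctionExistenceSigned
import Literature.NumberTheory.EllipticCurves.Gross2004.RationalCharacterLSeriesHolds
import Literature.NumberTheory.EllipticCurves.HeegnerPointsOfConductorRationalityProofs
import HarnessLib

/-!
# Route `SchneiderFreeAdditiveX3` (K1 door), crux r3 `GordTwoBranchIMC` (stmt-BirchSwinnertonDyer-19177) ON THE LZZ/♭ ROAD:
# the (G-ord, `e = 2`) lower socket and the rung LEAF from PUBLISHED facts + Keller–Yin's PREPRINT claims ONLY —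
# `CHFrameValueVOff` (not in print, 2 003 off-scope pairs), the scoped value fact V⁺ and Cai–Shu–Tian RETIRED from the leaf

Cell `bsd-schneider-ideate`, seat `bsd-schneider-door-c5` (prover, generation 20; assembly layer).  PARTITION: board row
B6 ∩ X3 ∩ sst-twist, `r = 1`, (G-ord, `e = 2`) half (2 560 of 7 101 pairs), of `Rank1Residual.partition`; types-the-object-of
nothing new; closes none of B6's cells (BSD NOT advanced).  bears_on: K1-door (items 18971/18972 → 19177 r3, 19175/19393 targets).

THE ROAD (FINDING-door-c5-g19 §2b, completed).  Per Heegner datum of the cell and anticyclotomic frame `(κ, γ, 𝔭)`, at the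
CONJUGATE degree-one prime `𝔮 = 𝔭̄` and an embedding datum `ι′` inducing `𝔮`:
1. Castella–Hsieh (SIGNED existence, `castellaHsieh2018_exists_isBranchBDPLFunction_signed`, PUBLISHED; landed p637933) give a
   `χ_ε`-branch frame `L ∈ R₀⟦T⟧` of the good-ordinary member `Dt′.f = f̃` at `(ι′, 𝔮)` with branch constant a SIGN `e = ±1`,
   `Ω_p ∈ R₀^×`;
2. Keller–Yin Thm. 3.5.1 (PREPRINT: `thm351_imc_isTorsion_mu_zero_charIdeal_eq_OPEN` (i)(ii), `thm351_mu_zero_branch_OPEN`,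
   `thm351_charIdeal_eq_branch_OPEN`) at `(v, v̄) = (𝔮, 𝔭)` for the good member `W₁` of the isogeny class: `p ∤ L` and
   `Ch_Λ(X_ac^∅(W₁) at 𝔭)·R₀⟦T⟧ = (L)`; descent along the isogeny `W₁ → W` (`xac_charIdeal_map_le_of_ratIsogeny`):
   `Ch_Λ(X_ac^∅(W) at 𝔭)·R₀⟦T⟧ ⊆ (L)`;
3. BRANCH-vs-FLAT RIGIDITY (`LZZMatch.span_map_le_span_of_isBranchBDPLFunction_of_isBDPLFunctionInt`, landed p637681): for
   EVERY ♭-frame `Q ∈ 𝓞_{ℂ_p}⟦T⟧` of `Dt.f = f̃ ⊗ ε` at `(ι′, 𝔮)`: `(L) ⊆ (Q)` — because `ι′⁻¹(±1)` is `p`-integral — hence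
   `Ch_Λ(X_ac^∅(W) at 𝔭)·𝓞_{ℂ_p}⟦T⟧ ⊆ (Q)` = the hypothesis H3♭ᶜ of the ♭-socket at the conjugate prime (p634754);
4. the ♭-socket (Hsieh 2014 Thm. A — the frame; Liu–Zhang–Zhang 2018 — the value `Q(0) = u·(log_𝔮 P/c)²`, `‖u‖ = 1`;
   Kolyvagin — rank one, `(log_𝔮 P)² = (log_𝔭 P)²`; CTL₀ from the CLOSED control corner) gives
   `AdditiveIMCLowerBDPOnTreeLeAt` at the datum.
So:
* §1 `additiveIMCLowerBDPOnTreeLeAt_of_kolyvagin_of_hsieh_of_lzz_of_intDivConj` — the ♭-socket at ONE datum (p634754 §1, per datum);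
* §2 `xac_charIdeal_map_le_span_of_KY_of_castellaHsieh_signed` — steps 1–3 for the presented curve `C₂ • ((D • W′) ⊗ χ_{p*})`;
* the sequel `…LeafOfLZZMatch` assembles from §1–§2 the (G-ord, `e = 2`) socket off the `d_K = −3` sliver, the rung LEAF
  `SchneiderFree.AdditiveX3RankOneLower ⇐ PrintedFacts ∧ PotMultBranchIMC (r2) ∧ Hsieh ∧ LZZ ∧ KY ×3 ∧ CH-signed` (every
  input published or preprint: `CHFrameValueVOff`, the scoped value fact V⁺ and Cai–Shu–Tian leave the leaf's input ledger)
  and crux r3 BY NAME with the sliver.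

HONEST FRAMING: THEOREMS ONLY; pure composition of tree theorems; CONDITIONAL on the displayed hypotheses (Keller–Yin is an
unrefereed PREPRINT; crux r2 has no printed input); nothing is closed by me; BSD is proved for no curve; «closes rung: none».
References: [KellerYin2024b] arXiv:2410.23241 Thm. 3.5.1, Rem. 3.5.2, Assumption 2.0.3 (preprint); [CastellaHsieh2018] §3.3,
Def. 3.7, Prop. 3.8; [Hsieh2014] Thm. A; [LiuZhangZhang2018] Thm 1.5.1/1.5.3; [JetchevSkinnerWan2017] §7.4.1; [CaiShuTian2014]
Thm. 1.1; [Castella2018] Thm. 3.1; [Washington1997] §5.1, §7.1.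
-/

set_option autoImplicit false
-- `Summit.<P>.<Sub>` repeats `BirchSwinnertonDyer` by the tree's layout convention (D-0017)
set_option linter.dupNamespace false

noncomputable section

open scoped Classical NumberField

open Field NumberField IsDedekindDomain WeierstrassCurve PowerSeries
  Literature.NumberTheory.EllipticCurves Literature.NumberTheory.EllipticCurves.GreenbergSelmer
  Literature.NumberTheory.GaloisRepresentations Literature.NumberTheory.GaloisCohomology
  Literature.NumberTheory.EllipticCurves.ModularForms Literature.NumberTheory.EllipticCurves.Rank1Residual
  Literature.NumberTheory.EllipticCurves.KellerYin2024 Literature.NumberTheory.EllipticCurves.CaiShuTian2014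
  Summit.BirchSwinnertonDyer.Rank1Residual Summit.BirchSwinnertonDyer.Rank1Residual.X11b
  Summit.BirchSwinnertonDyer.Rank1Residual.X11b.AcSelmer Summit.BirchSwinnertonDyer.Rank1Residual.X11b.Halves
  Summit.BirchSwinnertonDyer.Rank1Residual.X11b.CongruenceLimit
  Summit.BirchSwinnertonDyer.BirchSwinnertonDyer.Theorems.SchneiderFree
  Summit.BirchSwinnertonDyer.BirchSwinnertonDyer.Theorems.SchneiderFree.KYRead
  Summit.BirchSwinnertonDyer.BirchSwinnertonDyer.Theses.SchneiderFreeAdditiveX3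
  Summit.BirchSwinnertonDyer.BirchSwinnertonDyer.Theorems.SchneiderFreeAdditiveX3.LZZMatch

namespace Summit.BirchSwinnertonDyer.BirchSwinnertonDyer.Theorems.SchneiderFreeAdditiveX3.ControlDischarged

/-! ### §1 The ♭-socket at the conjugate prime, ONE datum -/

/-- **The additive LOWER socket at ONE Heegner datum from Kolyvagin, Hsieh (any level), LZZ (additive) and the ♭-divisibility
AT THE CONJUGATE PRIME at that datum** — p634754's `additiveIMCLowerBDPInputManinAt_of_kolyvagin_of_hsieh_of_lzz_of_intDivConj`
read per datum (proof verbatim): CTL₀ gives `Ch_Λ(X_ac^∅ at 𝔭) = (f)`, `ord_p f(0) = n` (Poitou–Tate (i) is the tree theorem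
`pt_selmer_forall`); the conjugate degree-one prime `𝔮` and an embedding datum `ι′` inducing it; Hsieh gives a ♭-frame `Q` of
`Dt.f` at `(ι′, 𝔮)`; LZZ pins `Q(0) = u·(log_𝔮 P / c)²`, `‖u‖ = 1`; rank one (Kolyvagin) gives `(log_𝔮 P)² = (log_𝔭 P)²`; the
displayed divisibility puts `f` in `(Q)`; norms give `2·ord_p log_𝔭 P ≤ n + 2·v_p(c)`.  CONDITIONAL on `hKo`, `hA`, `hL`, `hDiv`;
nothing asserted about any curve. [cite: JetchevSkinnerWan2017, §7.4.1 (arXiv:1512.06894 p. 30)] [cite: Hsieh2014, Thm. A p. 712 (Doc. Math. 19)]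
[cite: LiuZhangZhang2018, Thm 1.5.1 and Thm 1.5.3 (Duke Math. J. 167 pp. 748–749)] [cite: SilvermanAEC2009, VIII.6.7 and IV.6.4] -/
theorem additiveIMCLowerBDPOnTreeLeAt_of_kolyvagin_of_hsieh_of_lzz_of_intDivConj
    (hKo : ∀ (N : ℕ) [NeZero N] (W : WeierstrassCurve ℚ) (K : Type) [Field K] [NumberField K],
      Literature.NumberTheory.EllipticCurves.kolyvagin N W K)
    (hA : Hsieh2014.thmA_exists_isHsiehLFunction_unrPeriod_anyLevel)
    (hL : LiuZhangZhang2018.thm151_thm153_modularCurve_heegnerVector_additive)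
    {W : WeierstrassCurve ℚ} [W.IsElliptic] [W.IsGloballyMinimal] {p : ℕ} [Fact p.Prime]
    (hp2 : p ≠ 2) (hX : ClassX3 W p) (hS : Additive.SubSemistableTwist W p)
    {N : ℕ} [NeZero N] {K : Type} [Field K] [NumberField K]
    (Dt : ModularParametrizationData W N) (H : HeegnerDatum N (NumberField.discr K)) (ι : K →+* ℂ)
    (P : (W.baseChange K).toAffine.Point)
    (hr' : W.analyticRank = 1) (hloc : Additive.N10.Locus W p) (hN : W.conductorNorm ℤ = N) (hK : IsImaginaryQuadratic K)
    (hodd : Odd (NumberField.discr K)) (hunit : ¬ p ∣ Units.torsionOrder K) (hHe : SatisfiesHeegnerHypothesis N K)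
    (hL1 : (W.quadraticTwist (NumberField.discr K : ℚ)).entireLFunction 1 ≠ 0)
    (hP : WeierstrassCurve.Affine.Point.map ι.toRatAlgHom P = heegnerPointComplex Dt H) (hnt : ¬ IsOfFinAddOrder P)
    (κ : ZpExtension K p) (hκ : κ.IsAnticyclotomic) (γ : Field.absoluteGaloisGroup K) [Fact (κ.IsTopGenerator γ)]
    (𝔭 : HeightOneSpectrum (𝓞 K)) (h𝔭 : ((p : ℕ) : 𝓞 K) ∈ 𝔭.asIdeal)
    (he : 𝔭.asIdeal.ramificationIdx (𝓞 ℚ) = 1) (hf : 𝔭.asIdeal.inertiaDeg (𝓞 ℚ) = 1)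
    (hDiv : ∀ (𝔮 : HeightOneSpectrum (𝓞 K)), ((p : ℕ) : 𝓞 K) ∈ 𝔮.asIdeal → 𝔭 ≠ 𝔮 →
      𝔮.asIdeal.ramificationIdx (𝓞 ℚ) = 1 → 𝔮.asIdeal.inertiaDeg (𝓞 ℚ) = 1 →
      ∀ (ι' : PadicAlgCl p ≃+* ℂ), BranchInducesPrime p ι' 𝔮 →
        ∀ (ΩK : ℂ) (Ωp : ℂ_[p]) (Q : PowerSeries (PadicComplexInt p)), ΩK ≠ 0 → Ωp ≠ 0 →
          R1.IsBDPLFunctionInt p ι' 𝔮 κ γ Dt.f ΩK Ωp Q →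
            (XAc.charIdeal (W.baseChange K) p κ 𝔭 ∅ γ).map (PowerSeries.map (R1.toCpInt p)) ≤ Ideal.span {Q}) :
    AdditiveIMCLowerBDPOnTreeLeAt p κ 𝔭 γ (embAt K p 𝔭 h𝔭 he hf) (padicValNat p Dt.c.natAbs) P := by
  have hp : p.Prime := Fact.out
  have hγ : κ.IsTopGenerator γ := Fact.out
  -- CTL₀ at `𝔭`: the characteristic ideal is principal with `ord_p f(0) = n`
  obtain ⟨n, hn⟩ := exists_hasCharValuationAt_of_pt_of_kolyvagin pt_selmer_forall hKo W p hr' hp2 hX hS N K Dt H ι P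
    hr' hloc hN hK hodd hunit hHe hL1 hP hnt κ hκ γ 𝔭 h𝔭 he hf
  -- `p² ∣ N`
  have haddv : Addv W p := hloc.2.1
  have hp2N : p ^ 2 ∣ N := by
    by_contra h
    rw [← hN] at h
    rcases hasGoodReductionAtPrime_or_hasMultiplicativeReductionAtPrime_of_not_sq_dvd_conductorNorm (V := W) h
      with hg | hm
    · exact haddv.1 hg
    · exact haddv.2 hm
  have hpN : p ∣ N := dvd_trans (dvd_pow_self p two_ne_zero) hp2N
  have hsplit : ((Ideal.span {(p : ℤ)}).primesOver (𝓞 K)).ncard = 2 := hHe p hp hpN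
  -- the conjugate degree-one prime `𝔮 = 𝔭̄`, an embedding datum inducing it, Hsieh's frame there
  obtain ⟨𝔮, h𝔮, hne, he', hf'⟩ := exists_conjugate_degreeOne hK.1 h𝔭 he hf
  obtain ⟨ι₀⟩ := PadicAlgCl.nonempty_ringEquiv_complex p
  obtain ⟨ι', -, hι'⟩ := exists_datum_forall_mem_iff p ι₀ hK h𝔮
  obtain ⟨lam, rlam, hlu, hinfl, hAQ, hunrl, havl, hfacl⟩ := lambdaSupplyAt hp2 ι' K κ hK hκ
  subst hN
  -- rank one over `K` (Kolyvagin), for the `𝔭 ↔ 𝔭̄` symmetry of `log_ω P`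
  have hrk : (W.baseChange K).mordellWeilRank = 1 := (hKo _ W K hK hHe ⟨Dt, H, ι, hP⟩ hnt).1
  obtain ⟨A, ΩK₀, C, Ωp, Q₀, hA0, hΩK₀, hC, hQ₀⟩ :=
    hA ι' K 𝔮 κ γ Dt.f lam rlam hp2 Dt.isNewformOf.1 hK hsplit h𝔮 hι' hHe hlu hinfl hAQ hunrl havl hfacl hκ hγ
  obtain ⟨ΩK, c, hΩK, -, hQ⟩ :=
    exists_isBDPLFunctionInt_of_isHsiehLFunction ι' 𝔮 κ γ Dt.f hpN hA0 hΩK₀ hC ((Ωp : unrIntegers p) : ℂ_[p]) hQ₀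
  have hΩp : ((Ωp : unrIntegers p) : ℂ_[p]) ≠ 0 := fun h0 ↦ by
    have h1 := norm_coe_units_unrIntegers p Ωp
    rw [h0, norm_zero] at h1
    exact zero_ne_one h1
  set Q : PowerSeries (PadicComplexInt p) := PowerSeries.C c * Q₀ with hQdef
  -- the value of the frame at `𝟙` (LZZ at `𝔭̄`, `‖u‖ = 1`), its logarithm moved to `𝔭`
  obtain ⟨u, hu, hval'⟩ :=
    UniversalToricDescentWaldspurgerFlat.intSeries_value_of_frame_tors hL W K 𝔮 κ γ Dt H ι P Dt.f Dt.isNewformOf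
      hp2 rfl hp2N hK hunit h𝔮 he' hf' hHe hκ hP hnt ι' hι' hΩK hΩp hQ
  set x : ℚ_[p] := logOmega W p (embAt K p 𝔭 h𝔭 he hf) P / (Dt.c : ℚ_[p]) with hx
  have hval : IntSeries.HasValueAt Q 0 (u * (algebraMap ℚ_[p] ℂ_[p] x) ^ 2) := by
    have hsq := sq_logOmega_embAt_eq_of_rank_one W p hK.1 hrk h𝔭 he hf h𝔮 he' hf' P
    have hx2 : (logOmega W p (embAt K p 𝔮 h𝔮 he' hf') P / (Dt.c : ℚ_[p])) ^ 2 = x ^ 2 := by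
      rw [hx, div_pow, div_pow, hsq]
    rw [← map_pow, ← hx2, map_pow]
    exact hval'
  -- the ♭-divisibility at this frame
  have hdiv := hDiv 𝔮 h𝔮 hne he' hf' ι' hι' ΩK _ Q hΩK hΩp hQ
  -- the lower norm half over `𝓞_{ℂ_p}⟦T⟧` (verbatim kmc)
  obtain ⟨htors, f, hfI, hf0, hfn⟩ := hn
  have hmem : PowerSeries.map (R1.toCpInt p) f ∈ Ideal.span {Q} := by
    have h3 := hdiv
    rw [hfI, map_span_singleton_powerSeries] at h3
    exact (Ideal.span_singleton_le_iff_mem _).mp h3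
  have hQ0 : u * (algebraMap ℚ_[p] ℂ_[p] x) ^ 2 = ((constantCoeff Q : PadicComplexInt p) : ℂ_[p]) :=
    R1.intSeries_eq_constantCoeff_of_hasValueAt_zero p hval
  obtain ⟨G, hG⟩ := Ideal.mem_span_singleton'.mp hmem
  have hfac : algebraMap ℚ_[p] ℂ_[p] ((constantCoeff f : ℤ_[p]) : ℚ_[p]) =
      ((constantCoeff G : PadicComplexInt p) : ℂ_[p]) * ((constantCoeff Q : PadicComplexInt p) : ℂ_[p]) := by
    rw [← R1.coe_toCpInt, ← constantCoeff_map_apply (R1.toCpInt p) f, ← hG, map_mul, MulMemClass.coe_mul]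
  have hp1 : (1 : ℝ) < p := by exact_mod_cast hp.one_lt
  have hnormf : ‖((constantCoeff f : ℤ_[p]) : ℚ_[p])‖ ≤ ‖x‖ ^ 2 := by
    calc ‖((constantCoeff f : ℤ_[p]) : ℚ_[p])‖
        = ‖algebraMap ℚ_[p] ℂ_[p] ((constantCoeff f : ℤ_[p]) : ℚ_[p])‖ := (norm_algebraMap' ℂ_[p] _).symm
      _ = ‖((constantCoeff G : PadicComplexInt p) : ℂ_[p])‖ * ‖((constantCoeff Q : PadicComplexInt p) : ℂ_[p])‖ := by
          rw [hfac, norm_mul]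
      _ ≤ 1 * ‖((constantCoeff Q : PadicComplexInt p) : ℂ_[p])‖ :=
          mul_le_mul_of_nonneg_right (R1.norm_coe_padicComplexInt_le_one p _) (norm_nonneg _)
      _ = ‖u‖ * ‖algebraMap ℚ_[p] ℂ_[p] x‖ ^ 2 := by rw [one_mul, ← hQ0, norm_mul, norm_pow]
      _ = ‖x‖ ^ 2 := by rw [hu, one_mul, norm_algebraMap']
  -- `x ≠ 0`
  have hlog : logOmega W p (embAt K p 𝔭 h𝔭 he hf) P ≠ 0 := R1.logOmega_ne_zero W p _ hnt
  have hc0 : Dt.c ≠ 0 := Dt.maninConstant_ne_zero_holds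
  have hc0' : (Dt.c : ℚ_[p]) ≠ 0 := by exact_mod_cast hc0
  have hx0 : x ≠ 0 := div_ne_zero hlog hc0'
  -- norms to valuations: `2·ord_p x ≤ ord_p f(0) = n`
  rw [← PadicInt.norm_def, PadicInt.norm_eq_zpow_neg_valuation hf0, Padic.norm_eq_zpow_neg_valuation hx0] at hnormf
  have hrhs : ((p : ℝ) ^ (-x.valuation)) ^ 2 = (p : ℝ) ^ (-(2 * x.valuation)) := by
    rw [← zpow_natCast ((p : ℝ) ^ (-x.valuation)) 2, ← zpow_mul]
    congr 1
    push_cast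
    ring
  rw [hrhs, zpow_le_zpow_iff_right₀ hp1] at hnormf
  have hle : 2 * x.valuation ≤ ((constantCoeff f).valuation : ℤ) := by omega
  rw [hx, div_eq_mul_inv, Padic.valuation_mul hlog (inv_ne_zero hc0'), Padic.valuation_inv,
    Padic.valuation_intCast, valuation_logOmega hlog, hfn] at hle
  refine ⟨n, ⟨htors, f, hfI, hf0, hfn⟩, ?_⟩
  simp only [padicValInt] at hle
  linarith

/-! ### §2 Steps 1–3 for the presented curve: the divisibility H3♭ᶜ at EVERY ♭-frame from Keller–Yin + Castella–Hsieh (signed) -/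

/-- **H3♭ᶜ at a ♭-frame of the conjugate prime ⇐ Keller–Yin Thm. 3.5.1 (PREPRINT ×3) ∧ Castella–Hsieh signed existence
(PUBLISHED) ∧ branch-vs-flat rigidity.**  For the door's presented curve `W = C₂ • ((D • W′) ⊗ χ_{p*})` (`W′` good at `p`,
parametrisation data `Dt` of `W` at level `N` and `Dt′` of `W′` at level `N′`, `p ∤ N′`) at a socket datum with `d_K` odd
`≠ −3` (`K/ℚ` Galois), the socket's degree-one `𝔭 ∋ p`, a second degree-one prime `𝔭′ ≠ 𝔭` above `p` and an `ι′` inducing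
`𝔭′`, a good member `W₁ →_φ W` (Keller–Yin's per-curve hypotheses), CTL₀ (torsion of `X_ac^∅(W_K)` at `𝔭`): for EVERY
♭-frame `Q` of `Dt.f` at `(ι′, 𝔭′)` with non-zero periods,
`Ch_Λ(X_ac^∅(W_K) at 𝔭)·𝓞_{ℂ_p}⟦T⟧ ⊆ (Q)`.  Proof: the signed branch frame `L` (`e = ±1`, `Ω_p ∈ R₀^×`) of
`(Dt′.f, χ_ε)` at `𝔭′`; Keller–Yin's `μ`-clause `p ∤ L` and equality `Ch(W₁)·R₀⟦T⟧ = (L)` at `(v, v̄) = (𝔭′, 𝔭)`; isogeny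
descent; `(L) ⊆ (Q)` by rigidity since `ι′⁻¹(±1) ∈ 𝓞_{ℂ_p}` (the twist relation at every `ℓ ≠ p`, `a_p(Dt.f) = 0`, the
levels off `p`, `K` unramified at `p` are the presentation's theorems).  CONDITIONAL on the named facts; nothing asserted
about BSD. [cite: KellerYin2024b, Thm. 3.5.1 and Rem. 3.5.2 (arXiv:2410.23241 p. 20) (preprint; hypotheses)]
[cite: CastellaHsieh2018, §3.3, Def. 3.7 and Prop. 3.8 (the signed branch frame)] [cite: Washington1997, §5.1 and §7.1] -/
theorem xac_charIdeal_map_le_span_of_KY_of_castellaHsieh_signed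
    (hCHσ : castellaHsieh2018_exists_isBranchBDPLFunction_signed)
    (hKY : thm351_imc_isTorsion_mu_zero_charIdeal_eq_OPEN) (hKYb : thm351_charIdeal_eq_branch_OPEN)
    (hKYμ : thm351_mu_zero_branch_OPEN) (hmodN : exists_isNewformOf)
    -- the prime, the good partner `W′`, the presentation of the door's curve
    {p : ℕ} [hp : Fact p.Prime] (hp2 : p ≠ 2) (W' : WeierstrassCurve ℚ) [W'.IsElliptic]
    (hgood : W'.HasGoodReductionAtPrime p) (D C₂ : VariableChange ℚ)
    [(C₂ • (D • W').quadraticTwist ((-1 : ℚ) ^ (p / 2) * p)).IsElliptic] {N : ℕ} [NeZero N]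
    (Dt : ModularParametrizationData (C₂ • (D • W').quadraticTwist ((-1 : ℚ) ^ (p / 2) * p)) N)
    {N' : ℕ} [NeZero N'] (Dt' : ModularParametrizationData W' N') (hpN' : ¬ p ∣ N')
    -- the socket's field, tower, primes, embedding datum; Heegner for `N` and for the partner's level
    {K : Type} [Field K] [NumberField K] [IsGalois ℚ K] (hK : IsImaginaryQuadratic K)
    (hHe : SatisfiesHeegnerHypothesis N K) (hHe' : SatisfiesHeegnerHypothesis N' K)
    (hodd : Odd (NumberField.discr K)) (hdK : NumberField.discr K ≠ -3)
    {κ : ZpExtension K p} (hκ : κ.IsAnticyclotomic) (γ : absoluteGaloisGroup K) [hγ : Fact (κ.IsTopGenerator γ)]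
    {𝔭 : HeightOneSpectrum (𝓞 K)} (h𝔭 : ((p : ℕ) : 𝓞 K) ∈ 𝔭.asIdeal)
    (he : 𝔭.asIdeal.ramificationIdx (𝓞 ℚ) = 1) (hf : 𝔭.asIdeal.inertiaDeg (𝓞 ℚ) = 1)
    {𝔭' : HeightOneSpectrum (𝓞 K)} (h𝔭' : ((p : ℕ) : 𝓞 K) ∈ 𝔭'.asIdeal) (hne : 𝔭 ≠ 𝔭')
    {ι' : PadicAlgCl p ≃+* ℂ} (hι' : BranchInducesPrime p ι' 𝔭')
    -- the good member of the isogeny class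
    {W₁ : WeierstrassCurve ℚ} [W₁.IsElliptic] [W₁.IsGloballyMinimal]
    (φ : WeierstrassCurve.Isogeny W₁ (C₂ • (D • W').quadraticTwist ((-1 : ℚ) ^ (p / 2) * p)))
    {m d : ℕ} (hdeg : φ.degree = p ^ m * d) (hd : ¬ p ∣ d)
    (hN₁ : W₁.conductorNorm ℤ = N) (hcase₁ : W₁.HasGoodOrdinaryReductionOverQuadraticAt p)
    (hred₁ : Red W₁ p)
    (hlat₁ : ∃ Φ : AddSubgroup (geomTorsion W₁ (p : ℤ)),
      IsRationalLine W₁ p Φ ∧ ¬ LineDecompositionTrivialAt W₁ p Φ)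
    (htf₁ : ∀ Q : (W₁.baseChange K).toAffine.Point, p • Q = 0 → Q = 0)
    -- torsion of the target module (on the door: the control corner's CTL₀)
    (hT : Module.IsTorsion (IwasawaAlgebra p)
      (XAc ((C₂ • (D • W').quadraticTwist ((-1 : ℚ) ^ (p / 2) * p)).baseChange K) p κ 𝔭 ∅ γ))
    -- the ♭-frame at the conjugate prime
    {ΩK' : ℂ} {Ωp' : ℂ_[p]} {Q : PowerSeries (PadicComplexInt p)} (hΩK' : ΩK' ≠ 0) (hΩp' : Ωp' ≠ 0)
    (hQ : R1.IsBDPLFunctionInt p ι' 𝔭' κ γ Dt.f ΩK' Ωp' Q) :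
    (XAc.charIdeal ((C₂ • (D • W').quadraticTwist ((-1 : ℚ) ^ (p / 2) * p)).baseChange K) p κ 𝔭 ∅ γ).map
        (PowerSeries.map (R1.toCpInt p)) ≤ Ideal.span {Q} := by
  have hsplit : ((Ideal.span {(p : ℤ)}).primesOver (𝓞 K)).ncard = 2 :=
    ncard_primesOver_eq_two_of_degreeOne hK.1 h𝔭 he hf
  -- the conductor exponent of `χ_ε` above the split prime `p` is `1` (Literature theorem)
  have hcond : ∀ 𝔮 : HeightOneSpectrum (𝓞 K), ((p : ℕ) : 𝓞 K) ∈ 𝔮.asIdeal →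
      (KellerYin2024.genusHeckeCharacter K p).HasConductorExponentAt 𝔮 1 := fun 𝔮 h𝔮 ↦
    KellerYin2024.genusHeckeCharacter_hasConductorExponentAt_one_of_split K p hp2 hK hsplit h𝔮
  -- step 1: the SIGNED branch frame of `(Dt′.f, χ_ε)` at `𝔭′` (Castella–Hsieh, published)
  obtain ⟨e, ΩK, Ωp, L, hesign, hΩK, hL⟩ := hCHσ ι' W' K 𝔭' κ γ Dt'.isNewformOf (KellerYin2024.genusHeckeCharacter K p) hp2
    hpN' hK hodd hdK hsplit h𝔭' hι' hHe' hκ hγ.out (KellerYin2024.genusHeckeCharacter_sq K p)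
    (fun w hw ↦ KellerYin2024.genusHeckeCharacter_isUnramifiedAt K p hw) hcond
  have he0 : e ≠ 0 := by rcases hesign with rfl | rfl <;> norm_num
  have hΩp : ((Ωp : unrIntegers p) : ℂ_[p]) ≠ 0 := by
    rw [Ne, ZeroMemClass.coe_eq_zero]
    exact Ωp.ne_zero
  -- step 2: Keller–Yin at `(v, v̄) = (𝔭′, 𝔭)` for the good member `W₁`
  have hS : PotOrdSetting ι' W₁ K 𝔭' 𝔭 κ N :=
    potOrdSetting_of_socketData hp2 ι' W₁ K 𝔭 𝔭' κ N hN₁ hcase₁ hred₁ hlat₁ htf₁ hK hHe hodd hdK hκ h𝔭 he hf hne hι'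
  have hf₁ : IsNewformOf W₁ Dt.f := Dt.isNewformOf.of_isIsogenous ⟨φ⟩
  obtain ⟨hT₁, hμ₁, -⟩ := hKY ι' W₁ K 𝔭' 𝔭 κ γ hf₁ hS
  have htw : ∃ S : Finset ℕ, ∀ ℓ : ℕ, ℓ.Prime → ℓ ∉ S →
      cuspCoeff Dt.f ℓ = ((legendreSym p ℓ : ℤ) : ℂ) * cuspCoeff Dt'.f ℓ :=
    exists_cofinite_cuspCoeff_eq_legendreSym_mul hp2 W' D C₂ Dt Dt'
  -- the `μ`-clause for the signed frame, then the equality `Ch(W₁)·R₀⟦T⟧ = (L)`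
  have hμ : ¬ PowerSeries.C (p : unrIntegers p) ∣ L :=
    hKYμ ι' W₁ K 𝔭' 𝔭 κ γ hf₁ hS Dt'.isNewformOf.1 hpN' htw e ΩK Ωp L hesign hΩK hL
  have heq := charIdeal_map_eq_span_of_branch_OPEN_of_not_dvd hKYb ι' W₁ K 𝔭' 𝔭 κ γ hf₁ hS Dt'.isNewformOf.1 hpN'
    htw he0 hΩK hΩp hL hμ (toUnr p) (coe_toUnr p)
  have hdiv₁ : (XAc.charIdeal (W₁.baseChange K) p κ 𝔭 ∅ γ).map (PowerSeries.map (toUnr p)) ≤ Ideal.span {L} := by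
    rw [xac_charIdeal_eq_literature, heq]
  -- descend along the isogeny (finite generation is unconditional; torsion of the target = `hT`)
  haveI : Module.Finite (IwasawaAlgebra p) (XAc (W₁.baseChange K) p κ 𝔭 ∅ γ) :=
    Literature.NumberTheory.EllipticCurves.Castella2018.AcSelmer.XAc.module_finite_empty _ p κ 𝔭 γ
  haveI : Module.Finite (IwasawaAlgebra p)
      (XAc ((C₂ • (D • W').quadraticTwist ((-1 : ℚ) ^ (p / 2) * p)).baseChange K) p κ 𝔭 ∅ γ) :=
    Literature.NumberTheory.EllipticCurves.Castella2018.AcSelmer.XAc.module_finite_empty _ p κ 𝔭 γ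
  have hdiv : (XAc.charIdeal ((C₂ • (D • W').quadraticTwist ((-1 : ℚ) ^ (p / 2) * p)).baseChange K) p κ 𝔭 ∅ γ).map
      (PowerSeries.map (toUnr p)) ≤ Ideal.span {L} :=
    xac_charIdeal_map_le_of_ratIsogeny κ 𝔭 ∅ γ φ hdeg hd hT₁ hT hμ₁ (PowerSeries.map (toUnr p)) hdiv₁
  -- step 3: rigidity — `(L) ⊆ (Q)` since the constant `ι′⁻¹(±1)` is integral
  have hKp : Algebra.IsUnramifiedIn (𝓞 K) (Ideal.span {(p : ℤ)}) := isUnramifiedIn_of_splitsTwo hK hsplit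
  obtain ⟨c, hc, -⟩ := exists_coe_eq_symm_of_sign (p := p) (ι := ι') hesign
  have hLQ : Ideal.span {PowerSeries.map (R1.unrToCpInt p) L} ≤ Ideal.span {Q} :=
    span_map_le_span_of_isBranchBDPLFunction_of_isBDPLFunctionInt hp2 hK hKp Dt.f Dt'.f
      (fun _ hℓ hℓp ↦ cuspCoeff_eq_legendreSym_mul_of_presentation hp2 W' D C₂ Dt.isNewformOf Dt'.isNewformOf hℓ hℓp)
      (cuspCoeff_prime_eq_zero_of_presentation hp2 W' hgood D C₂ Dt)
      (prime_dvd_level_of_presentation hmodN hp2 W' hgood D C₂ Dt)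
      (fun _ hℓ hℓp ↦ dvd_level_iff_dvd_level_partner_of_presentation hmodN hp2 W' hgood D C₂ Dt Dt' hℓ hℓp)
      hκ hγ.out hΩK hΩK' hΩp hΩp' hL hQ hc
  exact (map_toCpInt_le_span_of_map_toUnr_le_span hdiv).trans hLQ

end Summit.BirchSwinnertonDyer.BirchSwinnertonDyer.Theorems.SchneiderFreeAdditiveX3.ControlDischarged

end
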